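import Mathlib.LinearAlgebra.UnitaryGroup
import Literature.MathematicalPhysics.QuantumFieldTheory.Balaban1983to89.T4SmallFieldFloorCount

/-!
# T4SmallFieldFloorMoment — the (η) member's floor (Y) from COUNT AT THE SLOT'S OWN SCALE × CHEBYSHEV × a
SECOND-MOMENT residual (Y₂); and (Y′) itself from a TILTED second moment  [folklore bookkeeping, v1]

Cell `pub-balaban`, T⁴ sub-cell, lineage `t4-ne7c-p2` (spine estimate NE7c, node U5b/U5.E, COUNT × SUPPRESSION member
under the admitted-priced design (η)), generation 8.  KERNEL BOOKKEEPING ONLY: every analytic input is a HYPOTHESIS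
SHAPE (a binder), nothing of Bałaban's is asserted, no estimate is proved about his densities.  Imports the lineage's
gen-7 leaf `T4SmallFieldFloorCount` (and through it `T4SiblingInsertion`) and Mathlib ONLY; consumes BY NAME
`T4SiblingInsertion.SmallFieldFloor`, `….UniformSmallFieldFloor`, `T4SmallFieldFloorCount.lfEvent`, `….defect_le_count`,
`….smallFieldFloor_of_count_uniform`, `….integrable_indicator_mul`, `….ExpMomentRatio`; touches no §-body of any
existing file.

## WHAT GEN 7 LEFT (by name) and WHAT THIS FILE ADDS

`T4SmallFieldFloorCount` reduced the owed floor (Y) `UniformSmallFieldFloor ν p g c` to COUNT (`defect_le_count`: the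
profile's defect `1 − p_σ` is dominated by the sum over a finite index set `P(σ)` of one-variable large-field indicators
`𝟙{a ≤ |X_i|}` at the LOWERED threshold `a`) × SUPPRESSION (Chernoff, `𝟙{a ≤ |x|} ≤ e^{-γa²/2}e^{γx²/2}`) × the residual
(Y′) `ExpMomentRatio ν X g γ M` (`∫ e^{γX²/2}·g ≤ M·∫ g`), with binders `|P(σ)| ≤ P₀` and `P₀·M·e^{-β} < 1`.
This file adds three things, all inside the seat's technique «count the carrying terms PER SCALE and sum with the
per-term suppression»:

**(1) THE COUNT MUST BE TAKEN AT THE SLOT'S OWN SCALE (§2).**  The plaquettes READ by the printed cube function are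
plaquettes of the FINEST lattice.  [Balaban1988Convergent] (the cell's B14) = T. Bałaban, *Convergent renormalization
expansions for lattice gauge theories*, Commun. Math. Phys. 119 (1988) 243–285, p. 257 (render
`1988-cmp119-convergent-renormalization-p015` read as image; PDF page = journal page − 242): «We consider the partition
of the lattice T_η into LM₂R_k-cubes, compatible with the other partitions, and for each cube □ of this partition we
define the function U_{k,□}(V_k) by U_{k,□}(V_k) = U(B_k(□~⁴), M˙(Q_k^{s*}V_k)), (2.16)» and «χ_k(Ω_k) = Π_{□⊂Ω_k}
χ({sup_{p⊂□~}|U_{k,□}(V_k,∂p) − 1| < ε_kη²}), (2.17) where the cubes □ belong to the partition of the lattice T_η into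
cubes of the size LM₂R_k.»  [Balaban1989LargeFieldI] (the cell's B15) = T. Bałaban, *Large field renormalization. I*,
Commun. Math. Phys. 122 (1989) 175–202, p. 178 (render `1989-cmp122-large-field-I-p004` read as image; PDF page = journal page − 174),
(1.3) «χ({sup_{p⊂□~}|U_{j,□}(V_j,∂p) − 1| < ε_j(L^{k−j}η)²})» and «The cubes □ in (1.3) are the LM₂R_j-cubes of the
partition of the lattice T_{L^{−j}}, or the L^{−(k−j)}LM₂R_j-cubes of the lattice T_η».  So a cube of the level-`j`
condition has `L^{j}·LM₂R_j` sites of the finest lattice per side (side `L^{−(k−j)}LM₂R_j`, spacing `η = L^{−k}`), and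
the number of finest-lattice plaquettes in `□~` is about `6·(3LM₂R_j)⁴·L^{4j}`: it depends on the LEVEL `j` of the slot,
NOT on its age `k − j`, and is unbounded along the run (`j ≥ K − N` in the young band; sizes are side lengths in the
units of the step that defines the cube, cf. [Balaban1988Convergent] p. 246 «For the more natural scale L⁻¹ these are
partitions of the lattice T_{L⁻¹} into MR₁-cubes and LM₂R₁-cubes correspondingly»).  A union bound over THOSE plaquettes
is therefore never `K`-uniform, whatever the per-plaquette suppression.  The count is `K`-uniform (polynomial in
`LM₂R_j`) exactly when `P(σ)` is instantiated by the plaquettes of the slot's DETERMINING BLOCK FIELD at the slot's own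
scale; the cube-condition hypothesis `hp1` of `defect_le_count` then carries print's REGULARITY OF THE MINIMAL
CONFIGURATION — [Balaban1985Variational] (the cell's B11) = T. Bałaban, *The variational problem and background fields in
renormalization group method for lattice gauge theories*, Commun. Math. Phys. 102 (1985) 277–309 (renders
`1985-cmp102-variational-background-p002/p003` read as images; PDF page = journal page − 276), p. 278 (2): «|U(∂p) − 1|
= |(∂U)(p) − 1| < ε₀L^{−2j} = ε₀η²(L^jη)^{−2} for p ∈ Ω_j, j = 0, 1, …, k», (7): «|(∂V)(p′) − 1| < ε₁ for p′ ∈ 𝔅_k»,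
and p. 279 Theorem 1: «There exist positive constants a₀, a₁, B₃, B₄(β₀), M(ε₁), B₃a₁ ≤ a₀, such that for an
arbitrary configuration V satisfying (7) with ε₁ ≤ a₁ there exists a minimal orbit in the space
𝔘_k({Ω_j}, B₃ε₁) ∩ 𝔅_k(𝔅_k, V).» — i.e. block plaquettes below `ε₁` force the minimal configuration's finest
plaquettes below `B₃ε₁L^{−2j}` on `Ω_j`, LINEARLY in `ε₁ ≤ a₁`.  That is a PUBLISHED theorem the instantiating seat may
QUOTE (together with the localisation (2.16) it needs); HERE it enters ONLY as the hypothesis shape `RegularityTransfer`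
(§2: «all block variables below b ⇒ all read variables below a»), composed with the profile's plateau into `hp1` for the
BLOCK index set (`cubeCondition_of_transfer`), so that every theorem of gen 7 and of this file is applied with
`P(σ) =` the block plaquettes and the count stays polynomial.  Whether Theorem 1 applies verbatim to ℝ's localized
determining sets `B_j(□~⁴)` with the block field `M˙(Q_j^{s*}V_j)` is NOT asserted here.

**(2) CHEBYSHEV SUFFICES ONCE THE COUNT IS POLYNOMIAL (§1, §3, §4).**  The exponential-moment residual (Y′) is more
than the assembly needs.  With `0 < a`: `𝟙{a ≤ |x|} ≤ x²/a²`, so `∫ 𝟙{a ≤ |X_i|}·g ≤ (m₂/a²)·∫ g` under the WEAKER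
residual (Y₂) `SecondMomentRatio ν X g m₂ := Integrable (X²·g) ∧ ∫ X²·g ≤ m₂·∫ g` (ONE variable's second moment
under ℝ's exterior-pinned substituted density — NOT PRINTED, a binder; (Y′) ⇒ (Y₂) with `m₂ = 2M/γ`,
`secondMomentRatio_of_expMomentRatio`), and gen 7's `smallFieldFloor_of_count_uniform` gives the floor
`c = 1 − P₀·m₂/a²`.  The DICTIONARY (§3): if the variable's square is dominated by the plaquette's action density,
`X² ≤ κ·A` pointwise (for `U(N)`-valued plaquette matrices the Hilbert–Schmidt identity `Σ_{ij}|U_{ij} − δ_{ij}|² =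
2N − 2 Re tr U`, kernel-proved in §3 over `Matrix.unitaryGroup`), and the MEAN ACTION obeys `∫ A·g ≤ (g²E₀)·∫ g`
(`MeanRatio`, NOT PRINTED, a binder: «the mean Wilson action of ONE block plaquette, in units of g², is O(1) under the
pinned substituted density» — a FIRST-MOMENT statement), then `m₂ = κg²E₀`; with the lowered threshold transported
to the BLOCK family through the regularity constant, `b = (1−ρ₀)·g·P/B`, the ratio `m₂/b² = κE₀B²/((1−ρ₀)²P²)` is
`g`-FREE (`chebyshevRatio_eq`, whose `a` is this `b`).  POWER COUNTING (§4, pure real analysis): with `x = log g⁻²`, `P = p₀(g) = A₀x^{p₀}`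
([Balaban1988Convergent] p. 246, render `…-p004` read as image: «in the first step we take ε₀ = g₀p₀(g₀),
p₀(g₀) = A₀(log g₀⁻²)^{p₀}, p₀ ≥ 5r and A₀ is a sufficiently large constant» and «R₁ is the smallest power of L such,
that R₁ ≥ (log g₁⁻²)^r»), the block count is `≤ B′·x^s` with `s = 4r` and the ratio is `≤ C/x^q` with `q = 2p₀`; for
naturals `s < q` (print's «p₀ ≥ 5r» gives `4r < 2p₀` — WHICH window supplies `s < q` stays the hypothesis `hsq`) one
has `B′x^s·(C/x^q) ≤ 1/2` for `x ≥ max 1 (2B′C)` (`eventually_polyCount_mul_ratio_le_half`), whence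
`UniformSmallFieldFloor ν p g (1/2)` (`uniformSmallFieldFloor_half_of_polyCounting`): `rσ = 2` for the socket
(`T4LipschitzLedgerSocket` v1.1 §4′, consumer unchanged, cited by name only).

**(3) (Y′) ITSELF IS A TILTED SECOND MOMENT (§5).**  If the mean of the exponent under the TILTED weight `e^{u}·g` is
at most `c` (`∫ u·e^{u}g ≤ c·∫ e^{u}g`), then `∫ e^{u}g ≤ e^{c}·∫ g` (tangent line of `exp` at the tilted mean,
`Real.add_one_le_exp`; `integral_exp_mul_le_of_meanExponent`).  With `u = γX²/2`: (Y′) `ExpMomentRatio ν X g γ e^{γE/2}`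
follows from (Y₂) for the tilted weight, `SecondMomentRatio ν X (e^{γX²/2}·g) E` (`expMomentRatio_of_tiltedSecondMoment`).
So BOTH residual shapes of the (η) member are SECOND-MOMENT (= mean local action) statements: (Y₂) under the fibre
weight itself (Chebyshev, polynomial gain — enough by (2)), (Y′) under its one-plaquette tilt (Chernoff, Gaussian gain).
In print's currency the tilt `e^{γX²/2}` with `γ = 2δ/(κg²)` lowers ONE plaquette's coupling from `g⁻²` to
`(1−δ)g⁻²` — MECHANISM prose only, nothing asserted.

## HONEST LIMITS / THIS IS NOT
* NOT PRINTED and NOT proved here: (Y₂), `MeanRatio`/`E₀`, the applicability of [Balaban1985Variational] Theorem 1 to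
  ℝ's localized determining sets, the uniformity of `m₂`, `E₀`, `B`, `P₀` over fibres / exterior pinning / the position
  of the slot relative to the large-field core, the smallness `P₀·m₂/a² ≤ 1/2`, and `s < q`.  Each is a binder of the
  theorem that uses it.  The crude SUP bound available from the characteristic functions in force (`|X| ≲ 2L²·gp₀(g)`,
  [Balaban1988Convergent] p. 264) gives `m₂/a²` of order `L⁴B²(1−ρ₀)⁻² ≫ 1` and is USELESS — the content of `E₀ = O(1)`
  is that a block plaquette is typically of size `g`, far below the threshold `g·p₀(g)`.
* Rung (B)+1, finite `T⁴` only: NOT infinite volume, NOT a mass gap, NOT the Clay problem, NOT summit progress.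
  BetaPertH/(B)/(B^μ)/U5a stay explicit and conditional upstream.  ABSOLUTE RULE: the manuscripts are quoted for
  MECHANISM and LOCI only (pages and renders named above, read as images by this seat); no internally-minted statement is
  cited as a fact; [Balaban1985Variational] Theorem 1 is quoted verbatim and USED ONLY AS A HYPOTHESIS SHAPE.
-/

open MeasureTheory Finset

namespace Literature.MathematicalPhysics.QuantumFieldTheory.Balaban1983to89.T4SmallFieldFloorMoment

open T4SiblingInsertion T4SmallFieldFloorCount

/-! ## §1 CHEBYSHEV AT THE LOWERED THRESHOLD against the second-moment residual (Y₂) -/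

section Chebyshev

/-- **CHEBYSHEV, pointwise.**  For `0 < a` and `a ≤ |x|`: `1 ≤ x²/a²`. [folklore] -/
theorem one_le_sq_div_sq {a x : ℝ} (ha : 0 < a) (hx : a ≤ |x|) : 1 ≤ x ^ 2 / a ^ 2 := by
  rw [le_div_iff₀ (pow_pos ha 2), one_mul]
  calc a ^ 2 ≤ |x| ^ 2 := pow_le_pow_left₀ ha.le hx 2
    _ = x ^ 2 := sq_abs x

/-- **CHEBYSHEV, indicator form**: `𝟙{a ≤ |X ω|} ≤ (X ω)²/a²` at every point, for `0 < a`. [folklore] -/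
theorem indicator_le_sq_div_sq {Ω₀ : Type*} (X : Ω₀ → ℝ) {a : ℝ} (ha : 0 < a) (ω : Ω₀) :
    (lfEvent X a).indicator (fun _ => (1 : ℝ)) ω ≤ X ω ^ 2 / a ^ 2 := by
  by_cases hω : ω ∈ lfEvent X a
  · rw [Set.indicator_of_mem hω]; exact one_le_sq_div_sq ha hω
  · rw [Set.indicator_of_notMem hω]; positivity

variable {Ω₀ : Type*} [MeasurableSpace Ω₀]

/-- **MEAN RATIO** (hypothesis shape, NOT PRINTED): on one fibre with measure `ν` and weight `g`, the function `F·g` is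
integrable and its mass is at most `E` times the total mass, `∫ F·g ≤ E·∫ g`.  With `F = A/g²` the plaquette's action
density in units of `g²` this is the MEAN-ACTION residual `E₀`; with `F = X²` it is (Y₂).  Integrability is PART of the
shape (never junk-true). [folklore] -/
def MeanRatio (ν : Measure Ω₀) (F g : Ω₀ → ℝ) (E : ℝ) : Prop :=
  Integrable (fun ω => F ω * g ω) ν ∧ ∫ ω, F ω * g ω ∂ν ≤ E * ∫ ω, g ω ∂ν

/-- **(Y₂) THE ONE-VARIABLE SECOND-MOMENT RATIO** (hypothesis shape, NOT PRINTED; WEAKER than gen 7's (Y′)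
`ExpMomentRatio`, see `secondMomentRatio_of_expMomentRatio`): `∫ X²·g ≤ m₂·∫ g` with `X²·g` integrable. [folklore] -/
def SecondMomentRatio (ν : Measure Ω₀) (X g : Ω₀ → ℝ) (m₂ : ℝ) : Prop :=
  MeanRatio ν (fun ω => X ω ^ 2) g m₂

/-- Unfolding (Y₂). [folklore] -/
theorem secondMomentRatio_iff {ν : Measure Ω₀} {X g : Ω₀ → ℝ} {m₂ : ℝ} :
    SecondMomentRatio ν X g m₂ ↔
      Integrable (fun ω => X ω ^ 2 * g ω) ν ∧ ∫ ω, X ω ^ 2 * g ω ∂ν ≤ m₂ * ∫ ω, g ω ∂ν := Iff.rfl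

/-- The mean ratio is monotone in the constant (nonnegative total mass). [folklore] -/
theorem MeanRatio.mono {ν : Measure Ω₀} {F g : Ω₀ → ℝ} {E E' : ℝ} (h : MeanRatio ν F g E) (hE : E ≤ E')
    (hg : 0 ≤ ∫ ω, g ω ∂ν) : MeanRatio ν F g E' :=
  ⟨h.1, h.2.trans (mul_le_mul_of_nonneg_right hE hg)⟩

/-- (Y₂) is monotone in the constant (nonnegative total mass). [folklore] -/
theorem SecondMomentRatio.mono {ν : Measure Ω₀} {X g : Ω₀ → ℝ} {m₂ m₂' : ℝ} (h : SecondMomentRatio ν X g m₂)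
    (hm : m₂ ≤ m₂') (hg : 0 ≤ ∫ ω, g ω ∂ν) : SecondMomentRatio ν X g m₂' :=
  MeanRatio.mono h hm hg

/-- Scaling a mean ratio by a nonnegative constant: `∫ (c·F)·g ≤ (c·E)·∫ g`. [folklore] -/
theorem MeanRatio.const_mul {ν : Measure Ω₀} {F g : Ω₀ → ℝ} {E : ℝ} (h : MeanRatio ν F g E) {c : ℝ} (hc : 0 ≤ c) :
    MeanRatio ν (fun ω => c * F ω) g (c * E) := by
  refine ⟨(h.1.const_mul c).congr (Filter.Eventually.of_forall fun ω => by ring), ?_⟩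
  have e : (fun ω => c * F ω * g ω) = fun ω => c * (F ω * g ω) := by funext ω; ring
  rw [e, integral_const_mul, mul_assoc]
  exact mul_le_mul_of_nonneg_left h.2 hc

/-- Non-vacuity of the shape: the zero variable has second-moment ratio `0` for any integrable weight. [folklore] -/
theorem secondMomentRatio_zero {ν : Measure Ω₀} (g : Ω₀ → ℝ) :
    SecondMomentRatio ν (fun _ => 0) g 0 := by
  refine ⟨?_, ?_⟩
  · have e : (fun ω => (0 : ℝ) ^ 2 * g ω) = fun _ => 0 := by funext ω; simp
    rw [e]; exact integrable_zero _ _ _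
  · simp

/-- **ONE VARIABLE: CHEBYSHEV × (Y₂).**  `∫ 𝟙{a ≤ |X|}·g ≤ (m₂/a²)·∫ g` for `0 < a`, `g ≥ 0` a.e. [folklore] -/
theorem integral_indicator_mul_le_of_secondMoment {ν : Measure Ω₀} {X g : Ω₀ → ℝ} {a m₂ : ℝ} (hX : Measurable X)
    (ha : 0 < a) (hg0 : 0 ≤ᵐ[ν] g) (hg : Integrable g ν) (h2 : SecondMomentRatio ν X g m₂) :
    ∫ ω, (lfEvent X a).indicator (fun _ => (1 : ℝ)) ω * g ω ∂ν ≤ m₂ / a ^ 2 * ∫ ω, g ω ∂ν := by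
  have hig := integrable_indicator_mul hX a hg (ν := ν)
  have hcg : Integrable (fun ω => (X ω ^ 2 / a ^ 2) * g ω) ν :=
    (h2.1.div_const (a ^ 2)).congr (Filter.Eventually.of_forall fun ω => by ring)
  calc ∫ ω, (lfEvent X a).indicator (fun _ => (1 : ℝ)) ω * g ω ∂ν
      ≤ ∫ ω, (X ω ^ 2 / a ^ 2) * g ω ∂ν := by
        refine integral_mono_ae hig hcg ?_
        filter_upwards [hg0] with ω hgω
        exact mul_le_mul_of_nonneg_right (indicator_le_sq_div_sq X ha ω) hgω
    _ = (a ^ 2)⁻¹ * ∫ ω, X ω ^ 2 * g ω ∂ν := by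
        rw [← integral_const_mul]
        exact integral_congr_ae (Filter.Eventually.of_forall fun ω => by ring)
    _ ≤ (a ^ 2)⁻¹ * (m₂ * ∫ ω, g ω ∂ν) := mul_le_mul_of_nonneg_left h2.2 (by positivity)
    _ = m₂ / a ^ 2 * ∫ ω, g ω ∂ν := by ring

/-- `x² ≤ (2/γ)·e^{γx²/2}` for `0 < γ` (from `1 + y ≤ e^y`). [folklore] -/
theorem sq_le_div_mul_exp {γ : ℝ} (hγ : 0 < γ) (x : ℝ) : x ^ 2 ≤ 2 / γ * Real.exp (γ * x ^ 2 / 2) := by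
  have h := Real.add_one_le_exp (γ * x ^ 2 / 2)
  have h2 : γ * x ^ 2 / 2 ≤ Real.exp (γ * x ^ 2 / 2) := by linarith
  have e : 2 / γ * (γ * x ^ 2 / 2) = x ^ 2 := by field_simp
  calc x ^ 2 = 2 / γ * (γ * x ^ 2 / 2) := e.symm
    _ ≤ 2 / γ * Real.exp (γ * x ^ 2 / 2) := mul_le_mul_of_nonneg_left h2 (by positivity)

/-- **(Y′) ⇒ (Y₂)**: an exponential-moment ratio at `γ > 0` with constant `M` gives the second-moment ratio with
`m₂ = (2/γ)·M` — the new residual is GENUINELY WEAKER than gen 7's. [folklore] -/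
theorem secondMomentRatio_of_expMomentRatio {ν : Measure Ω₀} {X g : Ω₀ → ℝ} {γ M : ℝ} (hX : Measurable X)
    (hγ : 0 < γ) (hg0 : 0 ≤ᵐ[ν] g) (hg : Integrable g ν) (hE : ExpMomentRatio ν X g γ M) :
    SecondMomentRatio ν X g (2 / γ * M) := by
  have hbig : Integrable (fun ω => 2 / γ * Real.exp (γ * X ω ^ 2 / 2) * g ω) ν :=
    (hE.1.const_mul (2 / γ)).congr (Filter.Eventually.of_forall fun ω => by ring)
  have hdom : ∀ᵐ ω ∂ν, ‖X ω ^ 2 * g ω‖ ≤ 2 / γ * Real.exp (γ * X ω ^ 2 / 2) * g ω := by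
    filter_upwards [hg0] with ω hgω
    rw [Real.norm_eq_abs, abs_of_nonneg (mul_nonneg (sq_nonneg _) hgω)]
    exact mul_le_mul_of_nonneg_right (sq_le_div_mul_exp hγ (X ω)) hgω
  have hint : Integrable (fun ω => X ω ^ 2 * g ω) ν :=
    Integrable.mono' hbig ((hX.pow_const 2).aestronglyMeasurable.mul hg.aestronglyMeasurable) hdom
  refine ⟨hint, ?_⟩
  calc ∫ ω, X ω ^ 2 * g ω ∂ν ≤ ∫ ω, 2 / γ * Real.exp (γ * X ω ^ 2 / 2) * g ω ∂ν := by
        refine integral_mono_ae hint hbig ?_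
        filter_upwards [hg0] with ω hgω
        exact mul_le_mul_of_nonneg_right (sq_le_div_mul_exp hγ (X ω)) hgω
    _ = 2 / γ * ∫ ω, Real.exp (γ * X ω ^ 2 / 2) * g ω ∂ν := by
        rw [← integral_const_mul]
        exact integral_congr_ae (Filter.Eventually.of_forall fun ω => by ring)
    _ ≤ 2 / γ * (M * ∫ ω, g ω ∂ν) := mul_le_mul_of_nonneg_left hE.2 (by positivity)
    _ = 2 / γ * M * ∫ ω, g ω ∂ν := by ring

variable {ν : Measure Ω₀} {p g : Ω₀ → ℝ} {ι : Type*}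

/-- **(Y) ON ONE FIBRE ⇐ COUNT × CHEBYSHEV × (Y₂).**  Data: the finite index set `P` (the BLOCK plaquettes of the slot,
§2), `|P| ≤ P₀`, measurable variables `X_i`; the lowered threshold `0 < a`; `g ≥ 0` a.e., `g` and `p·g` integrable; the
cube condition in its a.e. consequence `1 − p ≤ Σ_{i∈P} 𝟙{a ≤ |X_i|}`; (Y₂) for every `i ∈ P` with ONE `m₂ ≥ 0`.
Conclusion: `SmallFieldFloor ν p g (1 − P₀·(m₂/a²))` — gen 7's `smallFieldFloor_of_count_uniform` with `q̄ = m₂/a²`.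
CONDITIONAL on its binders. [folklore] -/
theorem smallFieldFloor_of_count_secondMoment (P : Finset ι) (X : ι → Ω₀ → ℝ) {P₀ : ℕ} {a m₂ : ℝ}
    (hX : ∀ i ∈ P, Measurable (X i)) (ha : 0 < a) (hm : 0 ≤ m₂) (hg : Integrable g ν)
    (hpg : Integrable (fun ω => p ω * g ω) ν) (hg0 : 0 ≤ᵐ[ν] g)
    (hdom : ∀ᵐ ω ∂ν, 1 - p ω ≤ ∑ i ∈ P, (lfEvent (X i) a).indicator (fun _ => (1 : ℝ)) ω)
    (h2 : ∀ i ∈ P, SecondMomentRatio ν (X i) g m₂) (hP : P.card ≤ P₀) :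
    SmallFieldFloor ν p g (1 - P₀ * (m₂ / a ^ 2)) :=
  smallFieldFloor_of_count_uniform P (fun i ω => (lfEvent (X i) a).indicator (fun _ => (1 : ℝ)) ω) hg hpg
    (fun i hi => integrable_indicator_mul (hX i hi) a hg) hg0 hdom
    (fun i hi => integral_indicator_mul_le_of_secondMoment (hX i hi) ha hg0 hg (h2 i hi)) hP
    (div_nonneg hm (sq_nonneg a))

/-- The same with the cube condition supplied POINTWISE by the plateau of the profile (`defect_le_count`). [folklore] -/
theorem smallFieldFloor_of_cubeCondition_secondMoment (P : Finset ι) (X : ι → Ω₀ → ℝ) {P₀ : ℕ} {a m₂ : ℝ}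
    (hX : ∀ i ∈ P, Measurable (X i)) (ha : 0 < a) (hm : 0 ≤ m₂) (hg : Integrable g ν)
    (hpg : Integrable (fun ω => p ω * g ω) ν) (hg0 : 0 ≤ᵐ[ν] g) (hp0 : ∀ ω, 0 ≤ p ω)
    (hp1 : ∀ ω, (∀ i ∈ P, |X i ω| < a) → p ω = 1) (h2 : ∀ i ∈ P, SecondMomentRatio ν (X i) g m₂)
    (hP : P.card ≤ P₀) : SmallFieldFloor ν p g (1 - P₀ * (m₂ / a ^ 2)) :=
  smallFieldFloor_of_count_secondMoment P X hX ha hm hg hpg hg0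
    (Filter.Eventually.of_forall (defect_le_count P X hp0 hp1)) h2 hP

/-- **(Y) UNIFORMLY ⇐ COUNT × CHEBYSHEV × (Y₂) ON EVERY FIBRE**, ONE ratio bound.  Over the fibre index `J` of
`UniformSmallFieldFloor`: per fibre the data above with fibre-dependent `a_j > 0`, `m₂,j ≥ 0`, but ONE bound
`m₂,j/a_j² ≤ q̄`, ONE count `P₀`, and the EXPLICIT smallness `P₀·q̄ < 1`.  Conclusion:
`UniformSmallFieldFloor ν p g (1 − P₀·q̄)`, consumed by the socket as `rσ = (1 − P₀·q̄)⁻¹`.  CONDITIONAL on its binders.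
[folklore] -/
theorem uniformSmallFieldFloor_of_count_secondMoment {J : Type*} {Ω₁ : J → Type*}
    [∀ j, MeasurableSpace (Ω₁ j)] {ν : (j : J) → Measure (Ω₁ j)} {p g : (j : J) → Ω₁ j → ℝ}
    (P : J → Finset ι) (X : (j : J) → ι → Ω₁ j → ℝ) {P₀ : ℕ} (a m₂ : J → ℝ) {qbar : ℝ}
    (hX : ∀ j, ∀ i ∈ P j, Measurable (X j i)) (ha : ∀ j, 0 < a j) (hm : ∀ j, 0 ≤ m₂ j)
    (hq : ∀ j, m₂ j / a j ^ 2 ≤ qbar) (hg : ∀ j, Integrable (g j) (ν j))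
    (hpg : ∀ j, Integrable (fun ω => p j ω * g j ω) (ν j)) (hg0 : ∀ j, 0 ≤ᵐ[ν j] g j)
    (hdom : ∀ j, ∀ᵐ ω ∂ν j, 1 - p j ω ≤ ∑ i ∈ P j, (lfEvent (X j i) (a j)).indicator (fun _ => (1 : ℝ)) ω)
    (h2 : ∀ j, ∀ i ∈ P j, SecondMomentRatio (ν j) (X j i) (g j) (m₂ j)) (hP : ∀ j, (P j).card ≤ P₀)
    (hc : P₀ * qbar < 1) :
    UniformSmallFieldFloor ν p g (1 - P₀ * qbar) := by
  refine ⟨by linarith, fun j => ?_⟩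
  have h := smallFieldFloor_of_count_secondMoment (P j) (X j) (hX j) (ha j) (hm j) (hg j) (hpg j) (hg0 j)
    (hdom j) (h2 j) (hP j)
  refine h.mono ?_ (integral_nonneg_of_ae (hg0 j))
  have : (P₀ : ℝ) * (m₂ j / a j ^ 2) ≤ P₀ * qbar := mul_le_mul_of_nonneg_left (hq j) (Nat.cast_nonneg _)
  linarith

/-- **(Y) UNIFORMLY FROM ONE DEFECT BUDGET, fibre-dependent constants (Chebyshev form).**  Per fibre `j`: its own count
`|P_j|`, threshold `a_j > 0`, moment `m₂,j ≥ 0`, and the single budget `|P_j|·(m₂,j/a_j²) ≤ 1 − c` with `0 < c`.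
Conclusion: `UniformSmallFieldFloor ν p g c`.  (The form §4's polynomial power counting feeds, with `c = 1/2`.)
CONDITIONAL on its binders. [folklore] -/
theorem uniformSmallFieldFloor_of_budget_secondMoment {J : Type*} {Ω₁ : J → Type*}
    [∀ j, MeasurableSpace (Ω₁ j)] {ν : (j : J) → Measure (Ω₁ j)} {p g : (j : J) → Ω₁ j → ℝ}
    (P : J → Finset ι) (X : (j : J) → ι → Ω₁ j → ℝ) (a m₂ : J → ℝ) {c : ℝ}
    (hX : ∀ j, ∀ i ∈ P j, Measurable (X j i)) (ha : ∀ j, 0 < a j) (hm : ∀ j, 0 ≤ m₂ j)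
    (hg : ∀ j, Integrable (g j) (ν j)) (hpg : ∀ j, Integrable (fun ω => p j ω * g j ω) (ν j))
    (hg0 : ∀ j, 0 ≤ᵐ[ν j] g j)
    (hdom : ∀ j, ∀ᵐ ω ∂ν j, 1 - p j ω ≤ ∑ i ∈ P j, (lfEvent (X j i) (a j)).indicator (fun _ => (1 : ℝ)) ω)
    (h2 : ∀ j, ∀ i ∈ P j, SecondMomentRatio (ν j) (X j i) (g j) (m₂ j)) (hc : 0 < c)
    (hbudget : ∀ j, ((P j).card : ℝ) * (m₂ j / a j ^ 2) ≤ 1 - c) :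
    UniformSmallFieldFloor ν p g c := by
  refine ⟨hc, fun j => ?_⟩
  have h := smallFieldFloor_of_count_secondMoment (P j) (X j) (hX j) (ha j) (hm j) (hg j) (hpg j) (hg0 j)
    (hdom j) (h2 j) le_rfl
  exact h.mono (by linarith [hbudget j]) (integral_nonneg_of_ae (hg0 j))

end Chebyshev

/-! ## §2 THE COUNT AT THE SLOT'S OWN SCALE: the regularity-transfer slot

The index set of the union bound must be the BLOCK plaquettes of the slot's determining field (polynomially many in
`LM₂R_j`, `K`-uniform), not the finest-lattice plaquettes the printed `sup` reads (`6(3LM₂R_j)⁴L^{4j}` of them, header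
(1)).  The passage is print's regularity of the minimal configuration ([Balaban1985Variational] Theorem 1, quoted in
the header): «every block variable below `b` ⇒ every read variable below `a`» — typed here as a HYPOTHESIS SHAPE and
composed with the plateau of the profile.  Nothing is asserted about when the shape holds. [folklore] -/

section Transfer

variable {Ω₀ ι κ : Type*}

/-- **REGULARITY TRANSFER** (hypothesis shape; printed MECHANISM = [Balaban1985Variational] p. 279 Theorem 1 with
p. 278 (2), (7): block plaquettes below `ε₁ ≤ a₁` ⇒ the minimal configuration's finest plaquettes below `B₃ε₁L^{-2j}`
on `Ω_j`; in the dictionary `b = a/B₃` after normalising both families by their scale factors).  On every configuration: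
if every BLOCK variable `Y_k`, `k ∈ Pc`, is below `b` in absolute value, then every READ variable `X_i`, `i ∈ Pf`, is
below `a`.  NOT asserted for ℝ's localized determining sets — a binder. [folklore] -/
def RegularityTransfer (Pf : Finset ι) (Pc : Finset κ) (X : ι → Ω₀ → ℝ) (Y : κ → Ω₀ → ℝ) (a b : ℝ) : Prop :=
  ∀ ω, (∀ k ∈ Pc, |Y k ω| < b) → ∀ i ∈ Pf, |X i ω| < a

/-- Non-vacuity / the trivial inhabitant: a family transfers to itself at the same threshold. [folklore] -/
theorem regularityTransfer_self (P : Finset ι) (X : ι → Ω₀ → ℝ) (a : ℝ) : RegularityTransfer P P X X a a :=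
  fun _ h => h

/-- **DOMINATION ⇒ TRANSFER.**  If every read variable is dominated, configuration by configuration, by `B` times SOME
block variable (`B > 0`; equivalently by `B ×` the maximum over the block family), then the block family at threshold
`b` transfers to the read family at threshold `a = B·b` — the LINEAR form in which Theorem 1's conclusion
(`ε₀ = B₃ε₁`) is used. [folklore] -/
theorem regularityTransfer_of_dominated (Pf : Finset ι) (Pc : Finset κ) (X : ι → Ω₀ → ℝ) (Y : κ → Ω₀ → ℝ)
    {B b : ℝ} (hB : 0 < B) (hdom : ∀ ω, ∀ i ∈ Pf, ∃ k ∈ Pc, |X i ω| ≤ B * |Y k ω|) :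
    RegularityTransfer Pf Pc X Y (B * b) b := by
  intro ω hY i hi
  obtain ⟨k, hk, hle⟩ := hdom ω i hi
  calc |X i ω| ≤ B * |Y k ω| := hle
    _ < B * b := mul_lt_mul_of_pos_left (hY k hk) hB

/-- **THE CUBE CONDITION FOR THE BLOCK FAMILY.**  Regularity transfer ∘ plateau of the profile on the read family =
the hypothesis `hp1` of `T4SmallFieldFloorCount.defect_le_count` for the BLOCK index set `Pc` at threshold `b`.
[folklore] -/
theorem cubeCondition_of_transfer (Pf : Finset ι) (Pc : Finset κ) (X : ι → Ω₀ → ℝ) (Y : κ → Ω₀ → ℝ)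
    {p : Ω₀ → ℝ} {a b : ℝ} (hreg : RegularityTransfer Pf Pc X Y a b)
    (hplateau : ∀ ω, (∀ i ∈ Pf, |X i ω| < a) → p ω = 1) :
    ∀ ω, (∀ k ∈ Pc, |Y k ω| < b) → p ω = 1 :=
  fun ω h => hplateau ω (hreg ω h)

/-- **⇒ THE COUNT IS OVER THE BLOCK FAMILY**: `1 − p ≤ Σ_{k∈Pc} 𝟙{b ≤ |Y_k|}` pointwise. [folklore] -/
theorem defect_le_blockCount (Pf : Finset ι) (Pc : Finset κ) (X : ι → Ω₀ → ℝ) (Y : κ → Ω₀ → ℝ)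
    {p : Ω₀ → ℝ} {a b : ℝ} (hp0 : ∀ ω, 0 ≤ p ω) (hreg : RegularityTransfer Pf Pc X Y a b)
    (hplateau : ∀ ω, (∀ i ∈ Pf, |X i ω| < a) → p ω = 1) (ω : Ω₀) :
    1 - p ω ≤ ∑ k ∈ Pc, (lfEvent (Y k) b).indicator (fun _ => (1 : ℝ)) ω :=
  defect_le_count Pc Y hp0 (cubeCondition_of_transfer Pf Pc X Y hreg hplateau) ω

variable [MeasurableSpace Ω₀] {ν : Measure Ω₀} {p g : Ω₀ → ℝ}

/-- **(Y) ON ONE FIBRE WITH THE COUNT AT THE SLOT'S SCALE.**  Plateau of the profile on the READ family `Pf` at the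
lowered threshold `a`; regularity transfer from the BLOCK family `Pc` at threshold `b > 0`; (Y₂) for the block variables
with ONE `m₂ ≥ 0`; `|Pc| ≤ P₀`.  Conclusion: `SmallFieldFloor ν p g (1 − P₀·(m₂/b²))` — the count is `|Pc|`, never the
number of read (finest-lattice) plaquettes.  CONDITIONAL on its binders. [folklore] -/
theorem smallFieldFloor_of_transfer_secondMoment (Pf : Finset ι) (Pc : Finset κ) (X : ι → Ω₀ → ℝ)
    (Y : κ → Ω₀ → ℝ) {P₀ : ℕ} {a b m₂ : ℝ} (hY : ∀ k ∈ Pc, Measurable (Y k)) (hb : 0 < b) (hm : 0 ≤ m₂)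
    (hg : Integrable g ν) (hpg : Integrable (fun ω => p ω * g ω) ν) (hg0 : 0 ≤ᵐ[ν] g) (hp0 : ∀ ω, 0 ≤ p ω)
    (hplateau : ∀ ω, (∀ i ∈ Pf, |X i ω| < a) → p ω = 1) (hreg : RegularityTransfer Pf Pc X Y a b)
    (h2 : ∀ k ∈ Pc, SecondMomentRatio ν (Y k) g m₂) (hP : Pc.card ≤ P₀) :
    SmallFieldFloor ν p g (1 - P₀ * (m₂ / b ^ 2)) :=
  smallFieldFloor_of_cubeCondition_secondMoment Pc Y hY hb hm hg hpg hg0 hp0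
    (cubeCondition_of_transfer Pf Pc X Y hreg hplateau) h2 hP

/-- The same slot feeds gen 7's Chernoff assembly: with (Y′) for the BLOCK variables the floor is
`1 − P₀·(M·e^{-γb²/2})`, count `|Pc| ≤ P₀`. [folklore] -/
theorem smallFieldFloor_of_transfer_expMoment (Pf : Finset ι) (Pc : Finset κ) (X : ι → Ω₀ → ℝ)
    (Y : κ → Ω₀ → ℝ) {P₀ : ℕ} {a b γ M : ℝ} (hY : ∀ k ∈ Pc, Measurable (Y k)) (hγ : 0 ≤ γ) (hb : 0 ≤ b)
    (hM : 0 ≤ M) (hg : Integrable g ν) (hpg : Integrable (fun ω => p ω * g ω) ν) (hg0 : 0 ≤ᵐ[ν] g)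
    (hp0 : ∀ ω, 0 ≤ p ω) (hplateau : ∀ ω, (∀ i ∈ Pf, |X i ω| < a) → p ω = 1)
    (hreg : RegularityTransfer Pf Pc X Y a b) (hE : ∀ k ∈ Pc, ExpMomentRatio ν (Y k) g γ M) (hP : Pc.card ≤ P₀) :
    SmallFieldFloor ν p g (1 - P₀ * (M * Real.exp (-(γ * b ^ 2 / 2)))) :=
  smallFieldFloor_of_cubeCondition Pc Y hY hγ hb hM hg hpg hg0 hp0
    (cubeCondition_of_transfer Pf Pc X Y hreg hplateau) hE hP

end Transfer

/-! ## §3 MEAN ACTION ⇒ SECOND MOMENT, and the `g`-free Chebyshev ratio -/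

section MeanAction

variable {Ω₀ : Type*} [MeasurableSpace Ω₀] {ν : Measure Ω₀}

/-- **SQUARE DOMINATED BY THE ACTION ⇒ (Y₂) FROM THE MEAN ACTION.**  If `X² ≤ κ·A` pointwise (`κ ≥ 0`; e.g. the
Hilbert–Schmidt identity below with `κ = 2N` and `A = 1 − Re tr U/N`), `X` is measurable, `g ≥ 0` a.e. is integrable,
and the mean-action ratio `∫ A·g ≤ E·∫ g` holds (`E = g²·E₀` in the dictionary), then (Y₂) holds with `m₂ = κ·E`.
[folklore] -/
theorem secondMomentRatio_of_sq_le {X A g : Ω₀ → ℝ} {κ E : ℝ} (hκ : 0 ≤ κ) (hXA : ∀ ω, X ω ^ 2 ≤ κ * A ω)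
    (hX : Measurable X) (hg0 : 0 ≤ᵐ[ν] g) (hg : Integrable g ν) (hA : MeanRatio ν A g E) :
    SecondMomentRatio ν X g (κ * E) := by
  have hbig : Integrable (fun ω => κ * A ω * g ω) ν :=
    (hA.1.const_mul κ).congr (Filter.Eventually.of_forall fun ω => by ring)
  have hle : ∀ᵐ ω ∂ν, X ω ^ 2 * g ω ≤ κ * A ω * g ω := by
    filter_upwards [hg0] with ω hgω
    exact mul_le_mul_of_nonneg_right (hXA ω) hgω
  have hdom : ∀ᵐ ω ∂ν, ‖X ω ^ 2 * g ω‖ ≤ κ * A ω * g ω := by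
    filter_upwards [hg0, hle] with ω hgω hleω
    rwa [Real.norm_eq_abs, abs_of_nonneg (mul_nonneg (sq_nonneg _) hgω)]
  have hint : Integrable (fun ω => X ω ^ 2 * g ω) ν :=
    Integrable.mono' hbig ((hX.pow_const 2).aestronglyMeasurable.mul hg.aestronglyMeasurable) hdom
  refine ⟨hint, ?_⟩
  calc ∫ ω, X ω ^ 2 * g ω ∂ν ≤ ∫ ω, κ * A ω * g ω ∂ν := integral_mono_ae hint hbig hle
    _ = κ * ∫ ω, A ω * g ω ∂ν := by
        rw [← integral_const_mul]
        exact integral_congr_ae (Filter.Eventually.of_forall fun ω => by ring)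
    _ ≤ κ * (E * ∫ ω, g ω ∂ν) := mul_le_mul_of_nonneg_left hA.2 hκ
    _ = κ * E * ∫ ω, g ω ∂ν := by ring

/-- **HILBERT–SCHMIDT IDENTITY ON THE UNITARY GROUP** (the dictionary `X² ≤ κ·A` with equality): for
`U ∈ Matrix.unitaryGroup (Fin N) ℂ`, `Σ_{i,j} |U_{ij} − δ_{ij}|² = 2N − 2·Re tr U`.  (So the squared Hilbert–Schmidt
distance of a plaquette matrix from `1` is `2N·(1 − Re tr U/N)`, `2N` times the normalised Wilson action density; the
operator-norm distance is at most the Hilbert–Schmidt one.) [folklore] -/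
theorem sum_normSq_sub_one_eq {N : ℕ} {U : Matrix (Fin N) (Fin N) ℂ} (hU : U ∈ Matrix.unitaryGroup (Fin N) ℂ) :
    ∑ i, ∑ j, Complex.normSq (U i j - (1 : Matrix (Fin N) (Fin N) ℂ) i j) = 2 * N - 2 * (Matrix.trace U).re := by
  have hUU : U * star U = 1 := Matrix.mem_unitaryGroup_iff.1 hU
  have h1 : ∀ i, ∑ j, Complex.normSq (U i j) = 1 := by
    intro i
    have h := congrFun (congrFun hUU i) i
    rw [Matrix.mul_apply, Matrix.one_apply_eq] at h
    have hs : ∑ j, U i j * (star U) j i = ∑ j, ((Complex.normSq (U i j) : ℝ) : ℂ) := by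
      refine Finset.sum_congr rfl fun j _ => ?_
      rw [Matrix.star_apply, Complex.star_def, Complex.mul_conj]
    rw [hs, ← Complex.ofReal_sum] at h
    exact_mod_cast h
  have h2 : ∀ i, ∑ j, Complex.normSq (U i j - (1 : Matrix (Fin N) (Fin N) ℂ) i j) =
      ∑ j, Complex.normSq (U i j) + (1 - 2 * (U i i).re) := by
    intro i
    have hs : ∀ j, Complex.normSq (U i j - (1 : Matrix (Fin N) (Fin N) ℂ) i j) =
        Complex.normSq (U i j) + if i = j then 1 - 2 * (U i i).re else 0 := by
      intro j
      by_cases hij : i = j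
      · subst hij
        simp only [Matrix.one_apply_eq, if_true, Complex.normSq_sub, map_one, mul_one]
        ring
      · rw [Matrix.one_apply_ne hij, if_neg hij, sub_zero, add_zero]
    simp_rw [hs, Finset.sum_add_distrib, Finset.sum_ite_eq, Finset.mem_univ, if_true]
  have htr : (Matrix.trace U).re = ∑ i, (U i i).re := by
    simp [Matrix.trace, Complex.re_sum]
  calc ∑ i, ∑ j, Complex.normSq (U i j - (1 : Matrix (Fin N) (Fin N) ℂ) i j)
      = ∑ i, (∑ j, Complex.normSq (U i j) + (1 - 2 * (U i i).re)) := Finset.sum_congr rfl fun i _ => h2 i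
    _ = ∑ i : Fin N, (2 - 2 * (U i i).re) := Finset.sum_congr rfl fun i _ => by rw [h1 i]; ring
    _ = ∑ _i : Fin N, (2 : ℝ) - ∑ i : Fin N, 2 * (U i i).re := Finset.sum_sub_distrib _ _
    _ = 2 * N - 2 * (Matrix.trace U).re := by
        rw [htr, Finset.mul_sum, Finset.sum_const, Finset.card_univ, Fintype.card_fin, nsmul_eq_mul]
        ring

/-- The normalised form of the identity's right side: `2N − 2t = 2N·(1 − t/N)` for `N ≠ 0`. [folklore] -/
theorem two_mul_sub_eq_normalised {N t : ℝ} (hN : N ≠ 0) : 2 * N - 2 * t = 2 * N * (1 - t / N) := by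
  field_simp

/-- **THE CHEBYSHEV RATIO IS `g`-FREE.**  With `m₂ = κ·(g²·E₀)` (mean action in units of `g²`) and the lowered,
regularity-transported threshold `a = (1−ρ₀)·(g·P)/B`:
`m₂/a² = κ·E₀·B²/((1−ρ₀)²·P²)` for `g ≠ 0`, `B ≠ 0`, `ρ₀ ≠ 1`, `P ≠ 0`. [folklore] -/
theorem chebyshevRatio_eq {κ E₀ B ρ₀ g P : ℝ} (hg : g ≠ 0) (hB : B ≠ 0) (hρ : ρ₀ ≠ 1) (hP : P ≠ 0) :
    κ * (g ^ 2 * E₀) / ((1 - ρ₀) * (g * P) / B) ^ 2 = κ * E₀ * B ^ 2 / ((1 - ρ₀) ^ 2 * P ^ 2) := by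
  have h1 : (1 - ρ₀) ≠ 0 := sub_ne_zero.2 (Ne.symm hρ)
  field_simp

/-- With the printed threshold function `P = A₀·x^{p₀}` the ratio is a constant over `x^{2p₀}`:
`(A₀·x^{p₀})² = A₀²·x^{2p₀}`. [folklore] -/
theorem thresholdSq_eq (A₀ x : ℝ) (p₀ : ℕ) : (A₀ * x ^ p₀) ^ 2 = A₀ ^ 2 * x ^ (2 * p₀) := by
  rw [mul_pow, ← pow_mul, mul_comm p₀ 2]

end MeanAction

/-! ## §4 POLYNOMIAL POWER COUNTING: count `≤ B·x^s`, ratio `≤ C/x^q`, `s < q` ⇒ floor `≥ 1/2` for `x ≥ max 1 (2BC)` -/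

section PowerCounting

/-- **POLYNOMIAL POWER COUNTING.**  For `0 ≤ B`, `0 ≤ C`, naturals `s < q` and `x ≥ max 1 (2·B·C)`:
`B·x^s·(C/x^q) ≤ 1/2`.  (In the cell: `s = 4r` from the block count of one enlarged `LM₂R_j`-cube, `q = 2p₀` from
`p₀(g)² `, and print's «p₀ ≥ 5r»; which window supplies `s < q` is NOT asserted.) [folklore] -/
theorem eventually_polyCount_mul_ratio_le_half {B C : ℝ} {s q : ℕ} (hB : 0 ≤ B) (hC : 0 ≤ C) (hsq : s < q) :
    ∀ x, max 1 (2 * B * C) ≤ x → B * x ^ s * (C / x ^ q) ≤ 1 / 2 := by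
  intro x hx
  have hx1 : 1 ≤ x := le_trans (le_max_left _ _) hx
  have hx0 : 0 < x := by linarith
  have hBC : 2 * B * C ≤ x := le_trans (le_max_right _ _) hx
  have hpow : x ^ s * x ≤ x ^ q := by
    calc x ^ s * x = x ^ (s + 1) := (pow_succ x s).symm
      _ ≤ x ^ q := pow_le_pow_right₀ hx1 (Nat.succ_le_of_lt hsq)
  have hxq : 0 < x ^ q := pow_pos hx0 q
  calc B * x ^ s * (C / x ^ q) = B * C * (x ^ s / x ^ q) := by ring
    _ ≤ B * C * (1 / x) := by
        refine mul_le_mul_of_nonneg_left ?_ (mul_nonneg hB hC)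
        rw [div_le_div_iff₀ hxq hx0, one_mul]
        exact hpow
    _ ≤ 1 / 2 := by
        rw [mul_one_div, div_le_iff₀ hx0]
        linarith

/-- **⇒ THE FLOOR IS AT LEAST `1/2`.**  If the count obeys `P₀ ≤ B·x^s` and the per-variable ratio obeys
`m₂/a² ≤ C/x^q`, then for `x ≥ max 1 (2BC)`: `1/2 ≤ 1 − P₀·(m₂/a²)`. [folklore] -/
theorem floor_ge_half_of_polyCounting {B C : ℝ} {s q : ℕ} (hB : 0 ≤ B) (hC : 0 ≤ C) (hsq : s < q) {x : ℝ}
    (hx : max 1 (2 * B * C) ≤ x) {P₀ m₂ a : ℝ} (hcount : P₀ ≤ B * x ^ s)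
    (hratio0 : 0 ≤ m₂ / a ^ 2) (hratio : m₂ / a ^ 2 ≤ C / x ^ q) :
    1 / 2 ≤ 1 - P₀ * (m₂ / a ^ 2) := by
  have h := eventually_polyCount_mul_ratio_le_half hB hC hsq x hx
  have hx1 : 1 ≤ x := le_trans (le_max_left _ _) hx
  have h1 : P₀ * (m₂ / a ^ 2) ≤ B * x ^ s * (C / x ^ q) :=
    mul_le_mul hcount hratio hratio0 (mul_nonneg hB (pow_nonneg (by linarith) s))
  linarith

/-- **END TO END: (Y) WITH `c = 1/2` FROM BLOCK COUNT × CHEBYSHEV × (Y₂) AND POLYNOMIAL POWER COUNTING.**  Per fibre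
`j` the data of `uniformSmallFieldFloor_of_budget_secondMoment` and a size parameter `x_j` (`= log g_j⁻²`) beyond
`max 1 (2BC)`, with count `|P_j| ≤ B·x_j^s` and ratio `m₂,j/a_j² ≤ C/x_j^q`, naturals `s < q`.  Conclusion:
`UniformSmallFieldFloor ν p g (1/2)` — `rσ = 2` for the socket.  EVERY analytic input is a binder: (Y₂) (`h2`, NOT
PRINTED), the count growth (`hcount`), the ratio decay (`hratio`), the ordering (`hsq`). [folklore] -/
theorem uniformSmallFieldFloor_half_of_polyCounting {ι J : Type*} {Ω₁ : J → Type*}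
    [∀ j, MeasurableSpace (Ω₁ j)] {ν : (j : J) → Measure (Ω₁ j)} {p g : (j : J) → Ω₁ j → ℝ}
    (P : J → Finset ι) (X : (j : J) → ι → Ω₁ j → ℝ) (a m₂ x : J → ℝ) {B C : ℝ} {s q : ℕ}
    (hB : 0 ≤ B) (hC : 0 ≤ C) (hsq : s < q)
    (hX : ∀ j, ∀ i ∈ P j, Measurable (X j i)) (ha : ∀ j, 0 < a j) (hm : ∀ j, 0 ≤ m₂ j)
    (hg : ∀ j, Integrable (g j) (ν j)) (hpg : ∀ j, Integrable (fun ω => p j ω * g j ω) (ν j))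
    (hg0 : ∀ j, 0 ≤ᵐ[ν j] g j)
    (hdom : ∀ j, ∀ᵐ ω ∂ν j, 1 - p j ω ≤ ∑ i ∈ P j, (lfEvent (X j i) (a j)).indicator (fun _ => (1 : ℝ)) ω)
    (h2 : ∀ j, ∀ i ∈ P j, SecondMomentRatio (ν j) (X j i) (g j) (m₂ j))
    (hx : ∀ j, max 1 (2 * B * C) ≤ x j) (hcount : ∀ j, ((P j).card : ℝ) ≤ B * x j ^ s)
    (hratio : ∀ j, m₂ j / a j ^ 2 ≤ C / x j ^ q) :
    UniformSmallFieldFloor ν p g (1 / 2) := by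
  refine uniformSmallFieldFloor_of_budget_secondMoment P X a m₂ hX ha hm hg hpg hg0 hdom h2 (by norm_num) fun j => ?_
  have h := floor_ge_half_of_polyCounting hB hC hsq (hx j) (hcount j)
    (div_nonneg (hm j) (sq_nonneg _)) (hratio j)
  linarith

end PowerCounting

/-! ## §5 THE TILT: (Y′) from a second moment under the TILTED weight -/

section Tilt

variable {Ω₀ : Type*} [MeasurableSpace Ω₀] {ν : Measure Ω₀}

/-- **TANGENT LINE, pointwise**: `e^{-c}·(1 − (u − c)) ≤ e^{-u}`. [folklore] -/
theorem exp_neg_mul_one_sub_le (u c : ℝ) : Real.exp (-c) * (1 - (u - c)) ≤ Real.exp (-u) := by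
  have h := Real.add_one_le_exp (-(u - c))
  have e : Real.exp (-u) = Real.exp (-c) * Real.exp (-(u - c)) := by rw [← Real.exp_add]; ring_nf
  rw [e]
  exact mul_le_mul_of_nonneg_left (by linarith) (Real.exp_pos _).le

/-- **MEAN OF THE EXPONENT UNDER THE TILTED WEIGHT ⇒ EXPONENTIAL MOMENT.**  Let `w = e^{u}·g` with `g ≥ 0` a.e.,
`g`, `w`, `u·w` integrable.  If `∫ u·w ≤ c·∫ w` (the `w`-mean of the exponent is at most `c`), then
`∫ e^{u}·g ≤ e^{c}·∫ g`.  Proof: `g = e^{-u}w ≥ e^{-c}(1 − (u − c))·w` pointwise, integrate.  (Convexity of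
`t ↦ log ∫ e^{tu}g` in one line.) [folklore] -/
theorem integral_exp_mul_le_of_meanExponent {u g : Ω₀ → ℝ} {c : ℝ} (hg0 : 0 ≤ᵐ[ν] g) (hg : Integrable g ν)
    (hw : Integrable (fun ω => Real.exp (u ω) * g ω) ν)
    (huw : Integrable (fun ω => u ω * (Real.exp (u ω) * g ω)) ν)
    (hmean : ∫ ω, u ω * (Real.exp (u ω) * g ω) ∂ν ≤ c * ∫ ω, Real.exp (u ω) * g ω ∂ν) :
    ∫ ω, Real.exp (u ω) * g ω ∂ν ≤ Real.exp c * ∫ ω, g ω ∂ν := by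
  set w : Ω₀ → ℝ := fun ω => Real.exp (u ω) * g ω with hwdef
  -- the affine minorant `(1 + c)·w − u·w`, scaled by `e^{-c}`
  have hlin : Integrable (fun ω => (1 + c) * w ω - u ω * w ω) ν := (hw.const_mul (1 + c)).sub huw
  have hminor : Integrable (fun ω => Real.exp (-c) * ((1 + c) * w ω - u ω * w ω)) ν := hlin.const_mul _
  have hpt : ∀ᵐ ω ∂ν, Real.exp (-c) * ((1 + c) * w ω - u ω * w ω) ≤ g ω := by
    filter_upwards [hg0] with ω hgω
    have hwω : 0 ≤ w ω := mul_nonneg (Real.exp_pos _).le hgω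
    have e1 : Real.exp (-c) * ((1 + c) * w ω - u ω * w ω) = (Real.exp (-c) * (1 - (u ω - c))) * w ω := by ring
    have e2 : g ω = Real.exp (-u ω) * w ω := by
      simp only [hwdef]; rw [← mul_assoc, ← Real.exp_add, neg_add_cancel, Real.exp_zero, one_mul]
    rw [e1, e2]
    exact mul_le_mul_of_nonneg_right (exp_neg_mul_one_sub_le (u ω) c) hwω
  have hI : Real.exp (-c) * ((1 + c) * ∫ ω, w ω ∂ν - ∫ ω, u ω * w ω ∂ν) ≤ ∫ ω, g ω ∂ν := by
    have := integral_mono_ae hminor hg hpt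
    rwa [integral_const_mul, integral_sub (hw.const_mul (1 + c)) huw, integral_const_mul] at this
  have hstep : Real.exp (-c) * ∫ ω, w ω ∂ν ≤ ∫ ω, g ω ∂ν := by
    have hm : (1 + c) * ∫ ω, w ω ∂ν - ∫ ω, u ω * w ω ∂ν ≥ ∫ ω, w ω ∂ν := by
      have := hmean; simp only [hwdef] at this ⊢; linarith
    calc Real.exp (-c) * ∫ ω, w ω ∂ν
        ≤ Real.exp (-c) * ((1 + c) * ∫ ω, w ω ∂ν - ∫ ω, u ω * w ω ∂ν) :=
          mul_le_mul_of_nonneg_left hm (Real.exp_pos _).le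
      _ ≤ ∫ ω, g ω ∂ν := hI
  calc ∫ ω, Real.exp (u ω) * g ω ∂ν = Real.exp c * (Real.exp (-c) * ∫ ω, w ω ∂ν) := by
        rw [← mul_assoc, ← Real.exp_add, add_neg_cancel, Real.exp_zero, one_mul]
    _ ≤ Real.exp c * ∫ ω, g ω ∂ν := mul_le_mul_of_nonneg_left hstep (Real.exp_pos _).le

/-- **(Y′) ⇐ (Y₂) FOR THE TILTED WEIGHT.**  With `w = e^{γX²/2}·g` (`γ ≥ 0`): if `w` and `X²·w` are integrable and
`∫ X²·w ≤ E·∫ w` — i.e. `SecondMomentRatio ν X w E` — then `ExpMomentRatio ν X g γ (e^{γE/2})`.  So the exponential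
moment gen 7 asks for is the SECOND MOMENT of the same variable under the one-plaquette-tilted weight. [folklore] -/
theorem expMomentRatio_of_tiltedSecondMoment {X g : Ω₀ → ℝ} {γ E : ℝ} (hγ : 0 ≤ γ) (hg0 : 0 ≤ᵐ[ν] g)
    (hg : Integrable g ν) (hw : Integrable (fun ω => Real.exp (γ * X ω ^ 2 / 2) * g ω) ν)
    (h2 : SecondMomentRatio ν X (fun ω => Real.exp (γ * X ω ^ 2 / 2) * g ω) E) :
    ExpMomentRatio ν X g γ (Real.exp (γ * E / 2)) := by
  refine ⟨hw, ?_⟩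
  have huw : Integrable (fun ω => (γ * X ω ^ 2 / 2) * (Real.exp (γ * X ω ^ 2 / 2) * g ω)) ν :=
    (h2.1.const_mul (γ / 2)).congr (Filter.Eventually.of_forall fun ω => by ring)
  have hmean : ∫ ω, (γ * X ω ^ 2 / 2) * (Real.exp (γ * X ω ^ 2 / 2) * g ω) ∂ν
      ≤ (γ * E / 2) * ∫ ω, Real.exp (γ * X ω ^ 2 / 2) * g ω ∂ν := by
    have e : (fun ω => (γ * X ω ^ 2 / 2) * (Real.exp (γ * X ω ^ 2 / 2) * g ω))
        = fun ω => (γ / 2) * (X ω ^ 2 * (Real.exp (γ * X ω ^ 2 / 2) * g ω)) := by funext ω; ring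
    rw [e, integral_const_mul]
    have := mul_le_mul_of_nonneg_left h2.2 (by positivity : (0 : ℝ) ≤ γ / 2)
    calc γ / 2 * ∫ ω, X ω ^ 2 * (Real.exp (γ * X ω ^ 2 / 2) * g ω) ∂ν
        ≤ γ / 2 * (E * ∫ ω, Real.exp (γ * X ω ^ 2 / 2) * g ω ∂ν) := this
      _ = (γ * E / 2) * ∫ ω, Real.exp (γ * X ω ^ 2 / 2) * g ω ∂ν := by ring
  exact integral_exp_mul_le_of_meanExponent (u := fun ω => γ * X ω ^ 2 / 2) hg0 hg hw huw hmean

end Tilt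

/-! ## §6 SANITY (honest scope): a two-point toy fibre on which §1 FIRES non-degenerately (and is TIGHT), a numeric
instance of §4, and kernel-checked negative controls

Toy, not Bałaban's densities.  Fibre `Bool` with the counting measure; one block variable (`ι = Unit`) `X true = 2`,
`X false = 0`; threshold `a = 2` (large-field event `{true}`); weight `g ≡ 1`; profile `p true = 0`, `p false = 1`.
(Y₂) holds with `m₂ = 2` (`∫ X²·g = 4 = 2·∫ g`), so the floor constant is `c = 1 − 1·(2/2²) = 1/2`, and indeed
`∫ p·g = 1 = (1/2)·∫ g`: the Chebyshev floor is ATTAINED.  NEGATIVE CONTROLS: Chebyshev needs `0 < a`; the power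
counting needs `s < q`. [folklore] -/

namespace Sanity

/-- Negative control (kernel-checked): the hypothesis `0 < a` of `one_le_sq_div_sq` cannot be weakened to `a ≤ |x|`
alone — at `a = -1`, `x = 0` one has `a ≤ |x|` but `x²/a² = 0 < 1`. [folklore] -/
example : ¬ ∀ a x : ℝ, a ≤ |x| → 1 ≤ x ^ 2 / a ^ 2 := by
  intro h
  have h1 := h (-1) 0 (by norm_num)
  norm_num at h1

/-- Negative control (kernel-checked): the ordering `s < q` of `eventually_polyCount_mul_ratio_le_half` cannot be
dropped — at `B = C = 1`, `s = q = 0`, `x = 2 ≥ max 1 (2BC)` the product is `1 > 1/2`. [folklore] -/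
example : ¬ ∀ (B C : ℝ) (s q : ℕ), 0 ≤ B → 0 ≤ C →
    ∀ x, max 1 (2 * B * C) ≤ x → B * x ^ s * (C / x ^ q) ≤ 1 / 2 := by
  intro h
  have h1 := h 1 1 0 0 (by norm_num) (by norm_num) 2 (by norm_num)
  norm_num at h1

/-- §4 at `B = C = 1`, `s = 1`, `q = 2`, `x = 2`: the bound `1/2` is attained (`1·2·(1/4) = 1/2`). [folklore] -/
example : (1 : ℝ) * 2 ^ 1 * (1 / 2 ^ 2) ≤ 1 / 2 :=
  eventually_polyCount_mul_ratio_le_half (B := 1) (C := 1) (s := 1) (q := 2) (by norm_num) (by norm_num)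
    (by norm_num) 2 (by norm_num)

/-- The toy block variable (toy data, not Bałaban's). [folklore] -/
def X : Bool → ℝ := fun b => if b then 2 else 0
/-- The toy profile: `1` off the large-field event, `0` on it (toy data). [folklore] -/
def p : Bool → ℝ := fun b => if b then 0 else 1
/-- The toy weight (toy data). [folklore] -/
def g : Bool → ℝ := fun _ => 1

open T4SmallFieldFloorCount.Sanity (integral_bool)

/-- (Y₂) holds on the toy with `m₂ = 2` (`∫ X²·g = 4`, `∫ g = 2`) (toy). [folklore] -/
theorem secondMomentRatio_toy : SecondMomentRatio (Measure.count : Measure Bool) X g 2 := by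
  refine ⟨Integrable.of_finite, ?_⟩
  rw [integral_bool, integral_bool]
  simp [X, g]
  norm_num

/-- The assembled §1 theorem FIRES on the toy: floor constant `c = 1 − 1·(2/2²)` (toy). [folklore] -/
theorem floor_toy : SmallFieldFloor (Measure.count : Measure Bool) p g (1 - (1 : ℕ) * ((2 : ℝ) / 2 ^ 2)) :=
  smallFieldFloor_of_cubeCondition_secondMoment ({()} : Finset Unit) (fun _ => X)
    (fun _ _ => (Measurable.of_discrete : Measurable X))
    (by norm_num) (by norm_num) Integrable.of_finite Integrable.of_finite
    (Filter.Eventually.of_forall fun b => by simp [g]) (fun b => by cases b <;> simp [p])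
    (fun b hb => by
      cases b
      · simp [p]
      · have := hb () (mem_singleton_self _); simp [X] at this)
    (fun _ _ => secondMomentRatio_toy) (by simp)

/-- The toy's floor constant is `1/2` and is ATTAINED: `∫ p·g = 1`, `∫ g = 2` (toy). [folklore] -/
theorem floor_toy_const : 1 - (1 : ℕ) * ((2 : ℝ) / 2 ^ 2) = 1 / 2 ∧
    ∫ b, p b * g b ∂(Measure.count : Measure Bool) = (1 / 2) * ∫ b, g b ∂(Measure.count : Measure Bool) := by
  refine ⟨by norm_num, ?_⟩
  rw [integral_bool, integral_bool]
  simp [p, g]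
  norm_num

end Sanity

end Literature.MathematicalPhysics.QuantumFieldTheory.Balaban1983to89.T4SmallFieldFloorMoment
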